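import Mathlib
import HarnessLib
import Summits.NavierStokesRegularity.NavierStokesRegularity.Theorems.PoloidalWindowDoorLrcModEntireTwistingTHLocalDatum
import Summits.NavierStokesRegularity.NavierStokesRegularity.Theorems.PoloidalWindowDoorPoloidalWindowRigidityThmARelocation

/-!
# Route `PoloidalWindowDoor`, item `LrcModEntire` (stmt-NavierStokesRegularity-20428), stub `stub_twistingTH` —
# THE STUB FROM THE **HYPERBOLIC** LOCAL EMPTINESS STATEMENT (`μ(p₀) < 0` granted)

Cell ns-regularity-ideate, seat ns-poloidal-K2-p3 gen 7 (lead of item 20428; file landed `--supports stmt-NavierStokesRegularity-20428`).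
Answers the interim K2 lead ns-poloidal-K2-p2 g6 (KERNEL-THMA-g6 §5, STATUS 22:39Z): «`hempty` may take `μ p₀.1 (p₀.2 2) < 0`», in the
GERM currency of item 20428 (twist_split v4's `stub_twistingTH`).  The `¬ IsBackwardSingularPoint` currency of crux 19708 (`mixed_type`
`stub_hyperbolicTH`, `lrc_jet` `stub_twisting` ∩ (TH)) is K2-p2 g6's `…LrcModEntireTwistingTHLocalHyp.stub_hyperbolicTH_of_localEmptyHyp`
(same hypothesis `hemptyHyp`, binder for binder) — not repeated here.

* `slope_neg_of_typeScalar_neg` — pointwise: the proportional-shear law `∂₂u_b = μ ∂_bu₂` (`b = 0,1`) and a negative type scalar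
  `∂₂u₀∂₀u₂ + ∂₂u₁∂₁u₂ < 0` force `μ < 0`.
* `exists_hyperbolicTHWindow` — K2-p2 g6's RELOCATION (the proof of `…ThmARelocation.twistingTH_regular_of_hyperbolicTH`, p580224,
  verbatim, exposed as an existence statement usable in every currency): a class profile (Type-I, continuous, Oseen-mild, div-free)
  with a nonempty open non-degenerate pinned twisting (TH) window `W` in the backward slab has a nonempty open non-degenerate pinned
  twisting **hyperbolic** (TH) window `W'` in the slab (Theorem A class form `…ThmAClass.exists_hyperbolic_point_of_TH` + identity theorem).
* `stub_twistingTH_of_localEmptyHyp` — the registered stub `stub_twistingTH` of `Cruxes/LrcModEntire/Lines/twist_split.lean` (v4), VERBATIM,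
  from the HYPERBOLIC local emptiness statement `hemptyHyp` = `hempty` of `…TwistingTHLocal.stub_twistingTH_of_localEmpty` with ONE MORE
  point condition `μ p₀.1 (p₀.2 2) < 0` before `False` (relocation, then `…TwistingTHLocalDatum.exists_localTHDatum` on `W'`, then the sign).
* `localTHEmptyHyp_of_localTHEmpty` — `hempty → hemptyHyp` (a fortiori), so the exact-certificate road
  (`…THCertFast2.stub_localTHEmpty_of_checkTreeS`) closes the hyperbolic statement too.

WHAT THIS IS NOT: not a claim about Navier–Stokes regularity and not the stub — the stub modulo the (weaker, sign-carrying) local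
statement (bears_on LADDER-NS N0, rung N0-LocalTubeDoorPoloidal, item 20428 / crux K2 = stmt-19708).
-/

noncomputable section

-- the summit and its single sub-problem share the name (CONVENTIONS §1), as in every Theorems file
set_option linter.dupNamespace false

namespace Summit.NavierStokesRegularity.NavierStokesRegularity.Theorems.PoloidalWindowDoorLrcModEntireTwistingTHLocalHypGerm

open Set Function Filter Topology Metric
open scoped RealInnerProductSpace InnerProductSpace Laplacian
open Literature.Analysis Literature.Analysis.FluidPDE
open Summit.NavierStokesRegularity.NavierStokesRegularity.Theorems.PoloidalWindowDoorPoloidalWindowRigidityThmAClass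
open Summit.NavierStokesRegularity.NavierStokesRegularity.Theorems.PoloidalWindowDoorPoloidalWindowRigidityTimeHeightShearNormalForm
open Summit.NavierStokesRegularity.NavierStokesRegularity.Theorems.PoloidalWindowDoorPoloidalWindowRigidityK2OfLrcSlope
open Summit.NavierStokesRegularity.NavierStokesRegularity.Theorems.TubeAlternative.AnalyticPropagation
open Summit.NavierStokesRegularity.NavierStokesRegularity.Theorems.PoloidalWindowDoorPoloidalWindowRigidityThmARelocation
open Summit.NavierStokesRegularity.NavierStokesRegularity.Theorems.PoloidalWindowDoorLrcModEntireTwistingTHLocalDatum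

/-! ### The sign of the slope at a hyperbolic point -/

/-- Pointwise: `a₀ = μ c₀`, `a₁ = μ c₁` and `a₀c₀ + a₁c₁ < 0` force `μ < 0` (the type scalar of a (TH) field is `μ‖∇ₕu₂‖²`). -/
theorem slope_neg_of_typeScalar_neg {a₀ a₁ c₀ c₁ μ : ℝ} (h0 : a₀ = μ * c₀) (h1 : a₁ = μ * c₁)
    (hI : a₀ * c₀ + a₁ * c₁ < 0) : μ < 0 := by
  rw [h0, h1] at hI
  by_contra hμ
  push Not at hμ
  nlinarith [mul_nonneg hμ (add_nonneg (mul_self_nonneg c₀) (mul_self_nonneg c₁))]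

/-! ### Relocation to a hyperbolic twisting (TH) window (K2-p2 g6's argument, as an existence statement) -/

/-- **RELOCATION.**  A class profile (Type-I, continuous, Oseen-mild, div-free) with a nonempty open window `W` in the backward slab that
is non-degenerate, pinned, twisting and (TH) has a nonempty open window `W'` in the slab that is non-degenerate, pinned, twisting,
HYPERBOLIC (`∂₂v₀∂₀v₂ + ∂₂v₁∂₁v₂ < 0` pointwise) and (TH).  Proof verbatim from `…ThmARelocation.twistingTH_regular_of_hyperbolicTH`. -/
theorem exists_hyperbolicTHWindow (C : ℝ) (v : ℝ → EuclideanSpace ℝ (Fin 3) → EuclideanSpace ℝ (Fin 3))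
    (hrate : Literature.Analysis.FluidPDE.HasTypeITimeDecay C v)
    (hcont : ContinuousOn (Function.uncurry v) (Set.Iio (0 : ℝ) ×ˢ Set.univ))
    (hmild : ∀ s t : ℝ, s < t → t < 0 → ∀ x, v t x =
      Literature.Analysis.UnboundedOperators.heatExtension (v s) (t - s) x -
        Literature.Analysis.FluidPDE.oseenDuhamel 1 s v v t x)
    (hdiv : ∀ t < 0, Literature.Analysis.FluidPDE.VectorCalculus.IsDivFree (v t))
    (W : Set (ℝ × EuclideanSpace ℝ (Fin 3))) (hW : IsOpen W) (hWne : W.Nonempty) (hWs : W ⊆ Set.Iio (0 : ℝ) ×ˢ Set.univ)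
    (hnd : ∀ z ∈ W, Literature.Analysis.FluidPDE.curl (v z.1) z.2 ≠ 0 ∧
      (fderiv ℝ (v z.1) z.2 (EuclideanSpace.single 0 1) 2 ≠ 0 ∨ fderiv ℝ (v z.1) z.2 (EuclideanSpace.single 1 1) 2 ≠ 0) ∧
      (fderiv ℝ (v z.1) z.2 (EuclideanSpace.single 2 1) 0 ≠ 0 ∨ fderiv ℝ (v z.1) z.2 (EuclideanSpace.single 2 1) 1 ≠ 0))
    (hpin : ∀ m : ℝ → ℝ, ∀ W₁ : Set (ℝ × EuclideanSpace ℝ (Fin 3)), W₁ ⊆ W → IsOpen W₁ → W₁.Nonempty →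
      ∃ z ∈ W₁, ∃ b : Fin 3, b ≠ 2 ∧
        fderiv ℝ (v z.1) z.2 (EuclideanSpace.single 2 1) b ≠
          m z.1 * fderiv ℝ (v z.1) z.2 (EuclideanSpace.single b 1) 2)
    (htw : ∀ z ∈ W,
      fderiv ℝ (fun x => fderiv ℝ (v z.1) x (EuclideanSpace.single 2 1) 2) z.2 (EuclideanSpace.single 0 1) *
          fderiv ℝ (v z.1) z.2 (EuclideanSpace.single 1 1) 2 -
        fderiv ℝ (fun x => fderiv ℝ (v z.1) x (EuclideanSpace.single 2 1) 2) z.2 (EuclideanSpace.single 1 1) *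
          fderiv ℝ (v z.1) z.2 (EuclideanSpace.single 0 1) 2 ≠ 0)
    (hTH : ∃ m : ℝ → ℝ → ℝ, ∀ z ∈ W, ∀ b : Fin 3, b ≠ 2 →
      fderiv ℝ (v z.1) z.2 (EuclideanSpace.single 2 1) b =
        m z.1 (z.2 2) * fderiv ℝ (v z.1) z.2 (EuclideanSpace.single b 1) 2) :
    ∃ W' : Set (ℝ × EuclideanSpace ℝ (Fin 3)), IsOpen W' ∧ W'.Nonempty ∧ W' ⊆ Set.Iio (0 : ℝ) ×ˢ Set.univ ∧
      (∀ z ∈ W', Literature.Analysis.FluidPDE.curl (v z.1) z.2 ≠ 0 ∧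
        (fderiv ℝ (v z.1) z.2 (EuclideanSpace.single 0 1) 2 ≠ 0 ∨ fderiv ℝ (v z.1) z.2 (EuclideanSpace.single 1 1) 2 ≠ 0) ∧
        (fderiv ℝ (v z.1) z.2 (EuclideanSpace.single 2 1) 0 ≠ 0 ∨ fderiv ℝ (v z.1) z.2 (EuclideanSpace.single 2 1) 1 ≠ 0)) ∧
      (∀ m : ℝ → ℝ, ∀ W₁ : Set (ℝ × EuclideanSpace ℝ (Fin 3)), W₁ ⊆ W' → IsOpen W₁ → W₁.Nonempty →
        ∃ z ∈ W₁, ∃ b : Fin 3, b ≠ 2 ∧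
          fderiv ℝ (v z.1) z.2 (EuclideanSpace.single 2 1) b ≠
            m z.1 * fderiv ℝ (v z.1) z.2 (EuclideanSpace.single b 1) 2) ∧
      (∀ z ∈ W',
        fderiv ℝ (fun x => fderiv ℝ (v z.1) x (EuclideanSpace.single 2 1) 2) z.2 (EuclideanSpace.single 0 1) *
            fderiv ℝ (v z.1) z.2 (EuclideanSpace.single 1 1) 2 -
          fderiv ℝ (fun x => fderiv ℝ (v z.1) x (EuclideanSpace.single 2 1) 2) z.2 (EuclideanSpace.single 1 1) *
            fderiv ℝ (v z.1) z.2 (EuclideanSpace.single 0 1) 2 ≠ 0) ∧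
      (∀ z ∈ W',
        fderiv ℝ (v z.1) z.2 (EuclideanSpace.single 2 1) 0 * fderiv ℝ (v z.1) z.2 (EuclideanSpace.single 0 1) 2 +
          fderiv ℝ (v z.1) z.2 (EuclideanSpace.single 2 1) 1 * fderiv ℝ (v z.1) z.2 (EuclideanSpace.single 1 1) 2 < 0) ∧
      (∃ m : ℝ → ℝ → ℝ, ∀ z ∈ W', ∀ b : Fin 3, b ≠ 2 →
        fderiv ℝ (v z.1) z.2 (EuclideanSpace.single 2 1) b =
          m z.1 (z.2 2) * fderiv ℝ (v z.1) z.2 (EuclideanSpace.single b 1) 2) := by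
  classical
  obtain ⟨m, hm⟩ := hTH
  -- the type scalar and the twist bracket as curried space–time functions
  set I : ℝ → EuclideanSpace ℝ (Fin 3) → ℝ := fun s y =>
    fderiv ℝ (v s) y (EuclideanSpace.single 2 1) 0 * fderiv ℝ (v s) y (EuclideanSpace.single 0 1) 2 +
      fderiv ℝ (v s) y (EuclideanSpace.single 2 1) 1 * fderiv ℝ (v s) y (EuclideanSpace.single 1 1) 2 with hI
  set T : ℝ → EuclideanSpace ℝ (Fin 3) → ℝ := fun s y =>
    fderiv ℝ (fun x => fderiv ℝ (v s) x (EuclideanSpace.single 2 1) 2) y (EuclideanSpace.single 0 1) *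
        fderiv ℝ (v s) y (EuclideanSpace.single 1 1) 2 -
      fderiv ℝ (fun x => fderiv ℝ (v s) x (EuclideanSpace.single 2 1) 2) y (EuclideanSpace.single 1 1) *
        fderiv ℝ (v s) y (EuclideanSpace.single 0 1) 2 with hT
  -- a product box around a point of `W`, inside `W` and inside the backward slab
  obtain ⟨z₀, hz₀⟩ := hWne
  have hs₀ : z₀.1 < 0 := (Set.mem_prod.1 (hWs hz₀)).1
  obtain ⟨ε, hε, hballW⟩ := Metric.isOpen_iff.1 hW z₀ hz₀
  obtain ⟨r, hr0, hrε, hrs⟩ : ∃ r : ℝ, 0 < r ∧ r ≤ ε ∧ r ≤ -z₀.1 :=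
    ⟨min ε (-z₀.1), lt_min hε (by linarith), min_le_left _ _, min_le_right _ _⟩
  have hbox : Set.Ioo (z₀.1 - r) (z₀.1 + r) ×ˢ Metric.ball z₀.2 r ⊆ W := by
    intro z hz
    apply hballW
    have h1 : z ∈ Metric.ball z₀.1 r ×ˢ Metric.ball z₀.2 r := by
      rw [Real.ball_eq_Ioo]; exact hz
    rw [ball_prod_same] at h1
    exact Metric.ball_subset_ball hrε h1
  have hJneg : ∀ s ∈ Set.Ioo (z₀.1 - r) (z₀.1 + r), s < 0 := fun s hs => by linarith [hs.2]
  -- THEOREM A (class form): the slice through `z₀` carries a hyperbolic point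
  set s : ℝ := z₀.1 with hsdef
  have hsJ : s ∈ Set.Ioo (z₀.1 - r) (z₀.1 + r) := ⟨by linarith, by linarith⟩
  have hs : s < 0 := hs₀
  obtain ⟨-, hnd1, hnd2⟩ := hnd z₀ hz₀
  obtain ⟨y, hy⟩ := exists_hyperbolic_point_of_TH hrate hcont hmild hdiv hW ⟨z₀, hz₀⟩ hWs hm hz₀ hnd1 hnd2
  have hy' : I s y < 0 := hy
  have hT₀ : T s z₀.2 ≠ 0 := htw _ hz₀
  -- a point of the slice `s` where the type scalar is negative AND the twist is non-zero
  obtain ⟨y₂, hIy₂, hTy₂⟩ : ∃ y₂ : EuclideanSpace ℝ (Fin 3), I s y₂ < 0 ∧ T s y₂ ≠ 0 := by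
    by_contra hcon
    push Not at hcon
    have hUo : IsOpen {y' : EuclideanSpace ℝ (Fin 3) | I s y' < 0} := by
      have hc : Continuous (I s) := by
        rw [hI]
        exact (typeScalar_analyticOnNhd_slice hrate hcont hmild hs).continuous
      exact isOpen_lt hc continuous_const
    have hTan : AnalyticOnNhd ℝ (T s) univ := by
      rw [hT]
      exact twist_analyticOnNhd_slice hrate hcont hmild hs
    have hev : T s =ᶠ[𝓝 y] 0 := by
      filter_upwards [hUo.mem_nhds hy'] with y' hy''
      exact hcon y' hy''
    have hzero := hTan.eqOn_zero_of_preconnected_of_eventuallyEq_zero isPreconnected_univ (Set.mem_univ y) hev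
    exact hT₀ (hzero (Set.mem_univ z₀.2))
  -- the relocated window
  have hslab : IsOpen (Set.Iio (0 : ℝ) ×ˢ (Set.univ : Set (EuclideanSpace ℝ (Fin 3)))) :=
    isOpen_Iio.prod isOpen_univ
  have hAo : IsOpen ((Set.Iio (0 : ℝ) ×ˢ Set.univ) ∩
      (fun z : ℝ × EuclideanSpace ℝ (Fin 3) => I z.1 z.2) ⁻¹' Set.Iio 0) := by
    have hc : ContinuousOn (fun z : ℝ × EuclideanSpace ℝ (Fin 3) => I z.1 z.2) (Set.Iio (0 : ℝ) ×ˢ Set.univ) := by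
      rw [hI]
      exact continuousOn_typeScalar hrate hcont hmild
    exact hc.isOpen_inter_preimage hslab isOpen_Iio
  have hBo : IsOpen ((Set.Iio (0 : ℝ) ×ˢ Set.univ) ∩
      (fun z : ℝ × EuclideanSpace ℝ (Fin 3) => T z.1 z.2) ⁻¹' {0}ᶜ) := by
    have hc : ContinuousOn (fun z : ℝ × EuclideanSpace ℝ (Fin 3) => T z.1 z.2) (Set.Iio (0 : ℝ) ×ˢ Set.univ) := by
      rw [hT]
      exact continuousOn_twist hrate hcont hmild
    exact hc.isOpen_inter_preimage hslab isOpen_compl_singleton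
  set W' : Set (ℝ × EuclideanSpace ℝ (Fin 3)) :=
    (Set.Ioo (z₀.1 - r) (z₀.1 + r) ×ˢ Set.univ) ∩
      (((Set.Iio (0 : ℝ) ×ˢ Set.univ) ∩ (fun z : ℝ × EuclideanSpace ℝ (Fin 3) => I z.1 z.2) ⁻¹' Set.Iio 0) ∩
       ((Set.Iio (0 : ℝ) ×ˢ Set.univ) ∩ (fun z : ℝ × EuclideanSpace ℝ (Fin 3) => T z.1 z.2) ⁻¹' {0}ᶜ)) with hW'
  have hW'o : IsOpen W' := (isOpen_Ioo.prod isOpen_univ).inter (hAo.inter hBo)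
  have hW'ne : W'.Nonempty :=
    ⟨(s, y₂), Set.mk_mem_prod hsJ (Set.mem_univ _),
      ⟨Set.mk_mem_prod hs (Set.mem_univ _), hIy₂⟩, ⟨Set.mk_mem_prod hs (Set.mem_univ _), hTy₂⟩⟩
  have hW's : W' ⊆ Set.Iio (0 : ℝ) ×ˢ Set.univ := fun z hz => hz.2.1.1
  have hW'J : ∀ z ∈ W', z.1 ∈ Set.Ioo (z₀.1 - r) (z₀.1 + r) := fun z hz => (Set.mem_prod.1 hz.1).1
  have hW'I : ∀ z ∈ W', I z.1 z.2 < 0 := fun z hz => hz.2.1.2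
  have hW'T : ∀ z ∈ W', T z.1 z.2 ≠ 0 := fun z hz => hz.2.2.2
  have hW'nd : ∀ z ∈ W', Literature.Analysis.FluidPDE.curl (v z.1) z.2 ≠ 0 ∧
      (fderiv ℝ (v z.1) z.2 (EuclideanSpace.single 0 1) 2 ≠ 0 ∨ fderiv ℝ (v z.1) z.2 (EuclideanSpace.single 1 1) 2 ≠ 0) ∧
      (fderiv ℝ (v z.1) z.2 (EuclideanSpace.single 2 1) 0 ≠ 0 ∨ fderiv ℝ (v z.1) z.2 (EuclideanSpace.single 2 1) 1 ≠ 0) :=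
    fun z hz => nd_of_typeScalar_neg (v z.1) z.2 (hW'I z hz)
  -- the pin transfers to the relocated window (identity theorem on each slice)
  have hW'pin : ∀ m : ℝ → ℝ, ∀ W₁ : Set (ℝ × EuclideanSpace ℝ (Fin 3)), W₁ ⊆ W' → IsOpen W₁ → W₁.Nonempty →
      ∃ z ∈ W₁, ∃ b : Fin 3, b ≠ 2 ∧
        fderiv ℝ (v z.1) z.2 (EuclideanSpace.single 2 1) b ≠
          m z.1 * fderiv ℝ (v z.1) z.2 (EuclideanSpace.single b 1) 2 := by
    intro m W₁ hW₁ hW₁o hW₁ne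
    by_contra hcon
    push Not at hcon
    obtain ⟨z₁, hz₁⟩ := hW₁ne
    obtain ⟨ρ, hρ, hballρ⟩ := Metric.isOpen_iff.1 hW₁o z₁ hz₁
    have hz₁J : z₁.1 ∈ Set.Ioo (z₀.1 - r) (z₀.1 + r) := hW'J z₁ (hW₁ hz₁)
    set W₂ : Set (ℝ × EuclideanSpace ℝ (Fin 3)) :=
      (Metric.ball z₁.1 ρ ∩ Set.Ioo (z₀.1 - r) (z₀.1 + r)) ×ˢ Metric.ball z₀.2 r with hW₂
    have hW₂W : W₂ ⊆ W := fun z hz =>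
      hbox (Set.mem_prod.2 ⟨(Set.mem_prod.1 hz).1.2, (Set.mem_prod.1 hz).2⟩)
    have hW₂o : IsOpen W₂ := (Metric.isOpen_ball.inter isOpen_Ioo).prod Metric.isOpen_ball
    have hW₂ne : W₂.Nonempty :=
      ⟨(z₁.1, z₀.2), Set.mk_mem_prod ⟨Metric.mem_ball_self hρ, hz₁J⟩ (Metric.mem_ball_self hr0)⟩
    obtain ⟨z, hzW₂, b, hb, hne⟩ := hpin m W₂ hW₂W hW₂o hW₂ne
    have hzt : z.1 ∈ Metric.ball z₁.1 ρ := (Set.mem_prod.1 hzW₂).1.1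
    have hzneg : z.1 < 0 := hJneg _ (Set.mem_prod.1 hzW₂).1.2
    have hrel : ∀ y' ∈ Metric.ball z₁.2 ρ,
        fderiv ℝ (v z.1) y' (EuclideanSpace.single 2 1) b = m z.1 * fderiv ℝ (v z.1) y' (EuclideanSpace.single b 1) 2 := by
      intro y' hy''
      have hmem' : (z.1, y') ∈ Metric.ball z₁.1 ρ ×ˢ Metric.ball z₁.2 ρ := Set.mk_mem_prod hzt hy''
      rw [ball_prod_same] at hmem'
      exact hcon _ (hballρ hmem') b hb
    have han := shearDefect_analyticOnNhd_slice hrate hcont hmild (m z.1) b hzneg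
    have hev : (fun y' => fderiv ℝ (v z.1) y' (EuclideanSpace.single 2 1) b -
        m z.1 * fderiv ℝ (v z.1) y' (EuclideanSpace.single b 1) 2) =ᶠ[𝓝 z₁.2] 0 := by
      filter_upwards [Metric.isOpen_ball.mem_nhds (Metric.mem_ball_self hρ)] with y' hy''
      show _ - _ = (0 : ℝ)
      rw [hrel y' hy'', sub_self]
    have hzero := han.eqOn_zero_of_preconnected_of_eventuallyEq_zero isPreconnected_univ (Set.mem_univ z₁.2) hev
    have h0 : fderiv ℝ (v z.1) z.2 (EuclideanSpace.single 2 1) b -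
        m z.1 * fderiv ℝ (v z.1) z.2 (EuclideanSpace.single b 1) 2 = 0 := hzero (Set.mem_univ z.2)
    exact hne (sub_eq_zero.1 h0)
  -- (TH) is global: the relocated window is (TH) with the global slope function
  have hNF := timeHeightShear_normalForm hrate hcont hmild hW ⟨z₀, hz₀⟩ hWs hm
  set m' : ℝ → ℝ → ℝ := fun t c =>
    if h : ∃ μ : ℝ, ∀ y : EuclideanSpace ℝ (Fin 3), y 2 = c → ∀ b : Fin 3, b ≠ 2 →
        fderiv ℝ (v t) y (EuclideanSpace.single 2 1) b = μ * fderiv ℝ (v t) y (EuclideanSpace.single b 1) 2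
    then Classical.choose h else 0 with hm'
  have hW'TH : ∃ m'' : ℝ → ℝ → ℝ, ∀ z ∈ W', ∀ b : Fin 3, b ≠ 2 →
      fderiv ℝ (v z.1) z.2 (EuclideanSpace.single 2 1) b =
        m'' z.1 (z.2 2) * fderiv ℝ (v z.1) z.2 (EuclideanSpace.single b 1) 2 := by
    refine ⟨m', fun z hz b hb => ?_⟩
    have hzneg : z.1 < 0 := (Set.mem_prod.1 (hW's hz)).1
    have hex : ∃ μ : ℝ, ∀ y : EuclideanSpace ℝ (Fin 3), y 2 = z.2 2 → ∀ b : Fin 3, b ≠ 2 →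
        fderiv ℝ (v z.1) y (EuclideanSpace.single 2 1) b = μ * fderiv ℝ (v z.1) y (EuclideanSpace.single b 1) 2 := by
      rcases hNF z.1 hzneg (z.2 2) with hflat | hμ
      · exfalso
        rcases (hW'nd z hz).2.1 with h | h
        · exact h (hflat z.2 rfl).1
        · exact h (hflat z.2 rfl).2
      · exact hμ
    have hm'z : m' z.1 (z.2 2) = Classical.choose hex := by
      simp only [hm', dif_pos hex]
    rw [hm'z]
    exact Classical.choose_spec hex z.2 rfl b hb
  exact ⟨W', hW'o, hW'ne, hW's, hW'nd, hW'pin, hW'T, hW'I, hW'TH⟩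

/-! ### The stub from the hyperbolic local emptiness statement -/

/-- **`stub_twistingTH` (twist_split v4, VERBATIM) from the HYPERBOLIC local emptiness statement.**  `hemptyHyp` is `hempty` of
`…TwistingTHLocal.stub_twistingTH_of_localEmpty` with one more point condition, `μ p₀.1 (p₀.2 2) < 0` (the slope is negative at the
base point: the local problem is the hyperbolic one).  Proof: relocate to a hyperbolic twisting (TH) window (`exists_hyperbolicTHWindow`),
take the local datum there (`exists_localTHDatum`), read the sign off the type scalar (`slope_neg_of_typeScalar_neg`). -/
theorem stub_twistingTH_of_localEmptyHyp
    (hemptyHyp : ∀ (u : ℝ → EuclideanSpace ℝ (Fin 3) → EuclideanSpace ℝ (Fin 3)) (μ A : ℝ → ℝ → ℝ)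
      (U : Set (ℝ × EuclideanSpace ℝ (Fin 3))) (p₀ : ℝ × EuclideanSpace ℝ (Fin 3)),
      IsOpen U → p₀ ∈ U →
      AnalyticOnNhd ℝ (Function.uncurry u) U →
      (∀ p ∈ U, AnalyticAt ℝ (Function.uncurry μ) (p.1, p.2 2)) →
      (∀ p ∈ U, AnalyticAt ℝ (Function.uncurry A) (p.1, p.2 2)) →
      (∀ p ∈ U, fderiv ℝ (u p.1) p.2 (EuclideanSpace.single 0 1) 1 = fderiv ℝ (u p.1) p.2 (EuclideanSpace.single 1 1) 0) →
      (∀ p ∈ U, fderiv ℝ (u p.1) p.2 (EuclideanSpace.single 0 1) 0 + fderiv ℝ (u p.1) p.2 (EuclideanSpace.single 1 1) 1 +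
        fderiv ℝ (u p.1) p.2 (EuclideanSpace.single 2 1) 2 = 0) →
      (∀ p ∈ U, ∀ b : Fin 3, b ≠ 2 →
        fderiv ℝ (u p.1) p.2 (EuclideanSpace.single 2 1) b =
          μ p.1 (p.2 2) * fderiv ℝ (u p.1) p.2 (EuclideanSpace.single b 1) 2) →
      (∀ p ∈ U,
        (1 - μ p.1 (p.2 2)) *
            (deriv (fun s => u s p.2 2) p.1 + fderiv ℝ (fun y => u p.1 y 2) p.2 (u p.1 p.2)
              - Δ (fun y => u p.1 y 2) p.2) =
          A p.1 (p.2 2) + (deriv (fun s => μ s (p.2 2)) p.1 - deriv (deriv (μ p.1)) (p.2 2)) * u p.1 p.2 2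
            + deriv (μ p.1) (p.2 2) / 2 * u p.1 p.2 2 ^ 2
            - 2 * deriv (μ p.1) (p.2 2) * fderiv ℝ (u p.1) p.2 (EuclideanSpace.single 2 1) 2) →
      fderiv ℝ (fun y => fderiv ℝ (u p₀.1) y (EuclideanSpace.single 2 1) 2) p₀.2 (EuclideanSpace.single 0 1) *
            fderiv ℝ (u p₀.1) p₀.2 (EuclideanSpace.single 1 1) 2 -
          fderiv ℝ (fun y => fderiv ℝ (u p₀.1) y (EuclideanSpace.single 2 1) 2) p₀.2 (EuclideanSpace.single 1 1) *
            fderiv ℝ (u p₀.1) p₀.2 (EuclideanSpace.single 0 1) 2 ≠ 0 →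
      μ p₀.1 (p₀.2 2) ≠ 0 → μ p₀.1 (p₀.2 2) ≠ 1 → deriv (μ p₀.1) (p₀.2 2) ≠ 0 →
      μ p₀.1 (p₀.2 2) < 0 → False) :
    ∀ (C : ℝ) (v : ℝ → EuclideanSpace ℝ (Fin 3) → EuclideanSpace ℝ (Fin 3)),
      Literature.Analysis.FluidPDE.HasTypeITimeDecay C v →
      ContinuousOn (Function.uncurry v) (Set.Iio (0 : ℝ) ×ˢ Set.univ) →
      (∀ s t : ℝ, s < t → t < 0 → ∀ x, v t x =
        Literature.Analysis.UnboundedOperators.heatExtension (v s) (t - s) x -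
          Literature.Analysis.FluidPDE.oseenDuhamel 1 s v v t x) →
      (∀ t < 0, Literature.Analysis.FluidPDE.VectorCalculus.IsDivFree (v t)) →
      (∀ s < 0, ∀ y, ⟪Literature.Analysis.FluidPDE.curl (v s) y, EuclideanSpace.single 2 1⟫_ℝ = 0) →
      ∀ W : Set (ℝ × EuclideanSpace ℝ (Fin 3)), IsOpen W → W.Nonempty → W ⊆ Set.Iio (0 : ℝ) ×ˢ Set.univ →
        (∀ z ∈ W, Literature.Analysis.FluidPDE.curl (v z.1) z.2 ≠ 0 ∧
          (fderiv ℝ (v z.1) z.2 (EuclideanSpace.single 0 1) 2 ≠ 0 ∨ fderiv ℝ (v z.1) z.2 (EuclideanSpace.single 1 1) 2 ≠ 0) ∧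
          (fderiv ℝ (v z.1) z.2 (EuclideanSpace.single 2 1) 0 ≠ 0 ∨ fderiv ℝ (v z.1) z.2 (EuclideanSpace.single 2 1) 1 ≠ 0)) →
        (∀ m : ℝ → ℝ, ∀ W₁ : Set (ℝ × EuclideanSpace ℝ (Fin 3)), W₁ ⊆ W → IsOpen W₁ → W₁.Nonempty →
          ∃ z ∈ W₁, ∃ b : Fin 3, b ≠ 2 ∧
            fderiv ℝ (v z.1) z.2 (EuclideanSpace.single 2 1) b ≠
              m z.1 * fderiv ℝ (v z.1) z.2 (EuclideanSpace.single b 1) 2) →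
        (∀ z ∈ W,
          fderiv ℝ (fun x => fderiv ℝ (v z.1) x (EuclideanSpace.single 2 1) 2) z.2 (EuclideanSpace.single 0 1) *
              fderiv ℝ (v z.1) z.2 (EuclideanSpace.single 1 1) 2 -
            fderiv ℝ (fun x => fderiv ℝ (v z.1) x (EuclideanSpace.single 2 1) 2) z.2 (EuclideanSpace.single 1 1) *
              fderiv ℝ (v z.1) z.2 (EuclideanSpace.single 0 1) 2 ≠ 0) →
        (∃ m : ℝ → ℝ → ℝ, ∀ z ∈ W, ∀ b : Fin 3, b ≠ 2 →
          fderiv ℝ (v z.1) z.2 (EuclideanSpace.single 2 1) b =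
            m z.1 (z.2 2) * fderiv ℝ (v z.1) z.2 (EuclideanSpace.single b 1) 2) →
        ∃ s : ℝ, s < 0 ∧ ∃ U : Set (EuclideanSpace ℝ (Fin 3)), IsOpen U ∧ U.Nonempty ∧
          ((∃ e : EuclideanSpace ℝ (Fin 3), e ≠ 0 ∧
              ∀ y ∈ U, fderiv ℝ (Literature.Analysis.FluidPDE.curl (v s)) y e = 0) ∨
           (∃ c : EuclideanSpace ℝ (Fin 3), ∀ y ∈ U,
              Literature.Analysis.FluidPDE.rotGen (Literature.Analysis.FluidPDE.curl (v s) y) =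
                fderiv ℝ (Literature.Analysis.FluidPDE.curl (v s)) y (Literature.Analysis.FluidPDE.rotGen (y - c))) ∨
           (∃ w : EuclideanSpace ℝ (Fin 3) → EuclideanSpace ℝ (Fin 3), AnalyticOnNhd ℝ w Set.univ ∧
              ¬ BddAbove (Set.range fun y => ‖w y‖) ∧ ∀ y ∈ U, v s y = w y)) := by
  intro C v hrate hcont hmild hdiv hpol W hW hWne hWs hnd hpin htw hTH
  exfalso
  obtain ⟨W', hW'o, hW'ne, hW's, hW'nd, hW'pin, hW'T, hW'I, m', hm'⟩ :=
    exists_hyperbolicTHWindow C v hrate hcont hmild hdiv W hW hWne hWs hnd hpin htw hTH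
  obtain ⟨μ, A, U, p₀, hUo, hp₀U, hUW, han, hμan, hAan, hpolU, hdivU, hsh, hE, htw0, hm0, hm1, hmz⟩ :=
    exists_localTHDatum hrate hcont hmild hdiv hpol hW'o hW'ne hW's hW'nd hW'pin hW'T hm'
  have hneg : μ p₀.1 (p₀.2 2) < 0 :=
    slope_neg_of_typeScalar_neg (hsh p₀ hp₀U 0 (by decide)) (hsh p₀ hp₀U 1 (by decide)) (hW'I p₀ (hUW hp₀U))
  exact hemptyHyp v μ A U p₀ hUo hp₀U han hμan hAan hpolU hdivU hsh hE htw0 hm0 hm1 hmz hneg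

/-- `hempty → hemptyHyp` (a fortiori: the hyperbolic statement has one more hypothesis), so an exact elimination certificate for the
sign-free local system (`…THCertFast2.stub_localTHEmpty_of_checkTreeS`) closes the hyperbolic statement as well. -/
theorem localTHEmptyHyp_of_localTHEmpty
    (hempty : ∀ (u : ℝ → EuclideanSpace ℝ (Fin 3) → EuclideanSpace ℝ (Fin 3)) (μ A : ℝ → ℝ → ℝ)
      (U : Set (ℝ × EuclideanSpace ℝ (Fin 3))) (p₀ : ℝ × EuclideanSpace ℝ (Fin 3)),
      IsOpen U → p₀ ∈ U →
      AnalyticOnNhd ℝ (Function.uncurry u) U →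
      (∀ p ∈ U, AnalyticAt ℝ (Function.uncurry μ) (p.1, p.2 2)) →
      (∀ p ∈ U, AnalyticAt ℝ (Function.uncurry A) (p.1, p.2 2)) →
      (∀ p ∈ U, fderiv ℝ (u p.1) p.2 (EuclideanSpace.single 0 1) 1 = fderiv ℝ (u p.1) p.2 (EuclideanSpace.single 1 1) 0) →
      (∀ p ∈ U, fderiv ℝ (u p.1) p.2 (EuclideanSpace.single 0 1) 0 + fderiv ℝ (u p.1) p.2 (EuclideanSpace.single 1 1) 1 +
        fderiv ℝ (u p.1) p.2 (EuclideanSpace.single 2 1) 2 = 0) →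
      (∀ p ∈ U, ∀ b : Fin 3, b ≠ 2 →
        fderiv ℝ (u p.1) p.2 (EuclideanSpace.single 2 1) b =
          μ p.1 (p.2 2) * fderiv ℝ (u p.1) p.2 (EuclideanSpace.single b 1) 2) →
      (∀ p ∈ U,
        (1 - μ p.1 (p.2 2)) *
            (deriv (fun s => u s p.2 2) p.1 + fderiv ℝ (fun y => u p.1 y 2) p.2 (u p.1 p.2)
              - Δ (fun y => u p.1 y 2) p.2) =
          A p.1 (p.2 2) + (deriv (fun s => μ s (p.2 2)) p.1 - deriv (deriv (μ p.1)) (p.2 2)) * u p.1 p.2 2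
            + deriv (μ p.1) (p.2 2) / 2 * u p.1 p.2 2 ^ 2
            - 2 * deriv (μ p.1) (p.2 2) * fderiv ℝ (u p.1) p.2 (EuclideanSpace.single 2 1) 2) →
      fderiv ℝ (fun y => fderiv ℝ (u p₀.1) y (EuclideanSpace.single 2 1) 2) p₀.2 (EuclideanSpace.single 0 1) *
            fderiv ℝ (u p₀.1) p₀.2 (EuclideanSpace.single 1 1) 2 -
          fderiv ℝ (fun y => fderiv ℝ (u p₀.1) y (EuclideanSpace.single 2 1) 2) p₀.2 (EuclideanSpace.single 1 1) *
            fderiv ℝ (u p₀.1) p₀.2 (EuclideanSpace.single 0 1) 2 ≠ 0 →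
      μ p₀.1 (p₀.2 2) ≠ 0 → μ p₀.1 (p₀.2 2) ≠ 1 → deriv (μ p₀.1) (p₀.2 2) ≠ 0 → False) :
    ∀ (u : ℝ → EuclideanSpace ℝ (Fin 3) → EuclideanSpace ℝ (Fin 3)) (μ A : ℝ → ℝ → ℝ)
      (U : Set (ℝ × EuclideanSpace ℝ (Fin 3))) (p₀ : ℝ × EuclideanSpace ℝ (Fin 3)),
      IsOpen U → p₀ ∈ U →
      AnalyticOnNhd ℝ (Function.uncurry u) U →
      (∀ p ∈ U, AnalyticAt ℝ (Function.uncurry μ) (p.1, p.2 2)) →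
      (∀ p ∈ U, AnalyticAt ℝ (Function.uncurry A) (p.1, p.2 2)) →
      (∀ p ∈ U, fderiv ℝ (u p.1) p.2 (EuclideanSpace.single 0 1) 1 = fderiv ℝ (u p.1) p.2 (EuclideanSpace.single 1 1) 0) →
      (∀ p ∈ U, fderiv ℝ (u p.1) p.2 (EuclideanSpace.single 0 1) 0 + fderiv ℝ (u p.1) p.2 (EuclideanSpace.single 1 1) 1 +
        fderiv ℝ (u p.1) p.2 (EuclideanSpace.single 2 1) 2 = 0) →
      (∀ p ∈ U, ∀ b : Fin 3, b ≠ 2 →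
        fderiv ℝ (u p.1) p.2 (EuclideanSpace.single 2 1) b =
          μ p.1 (p.2 2) * fderiv ℝ (u p.1) p.2 (EuclideanSpace.single b 1) 2) →
      (∀ p ∈ U,
        (1 - μ p.1 (p.2 2)) *
            (deriv (fun s => u s p.2 2) p.1 + fderiv ℝ (fun y => u p.1 y 2) p.2 (u p.1 p.2)
              - Δ (fun y => u p.1 y 2) p.2) =
          A p.1 (p.2 2) + (deriv (fun s => μ s (p.2 2)) p.1 - deriv (deriv (μ p.1)) (p.2 2)) * u p.1 p.2 2
            + deriv (μ p.1) (p.2 2) / 2 * u p.1 p.2 2 ^ 2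
            - 2 * deriv (μ p.1) (p.2 2) * fderiv ℝ (u p.1) p.2 (EuclideanSpace.single 2 1) 2) →
      fderiv ℝ (fun y => fderiv ℝ (u p₀.1) y (EuclideanSpace.single 2 1) 2) p₀.2 (EuclideanSpace.single 0 1) *
            fderiv ℝ (u p₀.1) p₀.2 (EuclideanSpace.single 1 1) 2 -
          fderiv ℝ (fun y => fderiv ℝ (u p₀.1) y (EuclideanSpace.single 2 1) 2) p₀.2 (EuclideanSpace.single 1 1) *
            fderiv ℝ (u p₀.1) p₀.2 (EuclideanSpace.single 0 1) 2 ≠ 0 →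
      μ p₀.1 (p₀.2 2) ≠ 0 → μ p₀.1 (p₀.2 2) ≠ 1 → deriv (μ p₀.1) (p₀.2 2) ≠ 0 →
      μ p₀.1 (p₀.2 2) < 0 → False := by
  intro u μ A U p₀ hU hp₀ hu hμ hA hpol hdiv hsh hE htw hm0 hm1 hmz _hneg
  exact hempty u μ A U p₀ hU hp₀ hu hμ hA hpol hdiv hsh hE htw hm0 hm1 hmz

end Summit.NavierStokesRegularity.NavierStokesRegularity.Theorems.PoloidalWindowDoorLrcModEntireTwistingTHLocalHypGerm

end
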